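import Mathlib
import HarnessLib
import Summits.AtomisticToContinuum.BoseEinsteinCondensation.Theses.BECNewtonPolicyIteration

/-!
# Route BECNewtonPolicyIteration — the glue item `LandscapeToPeriodicBEC`

Item stmt-AtomisticToContinuum-8961 (support, assembly glue). We prove the route decl
`Summit.AtomisticToContinuum.BoseEinsteinCondensation.Theses.BECNewtonPolicyIteration.LandscapeToPeriodicBEC`:

`PeriodicLandscapeBound → PeriodicRigidity → FlatModePeriodic → OccupationStabilityPeriodic →`
(for every repulsive finite-range `v`) constant-mode BEC of periodic near-minimisers on the torus of
side `(N/ρ)^{1/3}` at all small densities, with condensate occupation `≥ N/(4C)`.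

Proof (pure bookkeeping, as filed): `ρ₀ := min` of the landscape and rigidity thresholds,
`c := 1/(4C)`; eventually in `N = n + 1` take `η := 1/(4C)` in `PeriodicRigidity` to get `δ`; the
nonnegative `δ`-near-minimiser `Ψ` of `PeriodicLandscapeBound` has occupation `n₀(Ψ) ≥ N/C` by
`FlatModePeriodic`; for any `δ`-near-minimiser `Φ`, rigidity gives a unit `c₁` with
`‖Ψ - c₁Φ‖² ≤ η`, and `OccupationStabilityPeriodic` gives
`√(N/C) ≤ √n₀(Ψ) ≤ √n₀(Φ) + √N √η = √n₀(Φ) + √(N/C)/2`, whence `n₀(Φ) ≥ N/(4C)`.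
The only analysis-free core is the `ℝ≥0∞` square-root absorption lemma
`occupation_transfer_ennreal`.

References: LSSY2005 (Lieb–Seiringer–Solovej–Yngvason, *The Mathematics of the Bose Gas and its
Condensation*, 2005), Ch. 2; Fournais2020, (1.3)–(1.5) for the constant-mode occupation.
-/

namespace Summit.AtomisticToContinuum.BoseEinsteinCondensation.Theorems

open scoped ENNReal
open Filter Literature.MathematicalPhysics.QuantumManyBody.BoseGas

/-- `(4 : ℝ≥0∞) ^ (1/2) = 2`. [folklore] -/
theorem ennreal_four_rpow_half : (4 : ℝ≥0∞) ^ (1 / 2 : ℝ) = 2 := by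
  have h : (4 : ℝ≥0∞) = 2 ^ (2 : ℝ) := by rw [ENNReal.rpow_two]; norm_num
  rw [h, ← ENNReal.rpow_mul]
  norm_num

/-- Square-root absorption in `ℝ≥0∞` (the arithmetic core of the glue): if `N ≤ A·C`,
`√A ≤ √B + √N·√D` and `D ≤ 1/(4C)` with `C > 0` and `N < ∞`, then `N/(4C) ≤ B`.
Indeed `√(N/C) ≤ √A ≤ √B + √(N/C)/2`, so `√(N/C)/2 ≤ √B`. [folklore] -/
theorem occupation_transfer_ennreal {N A B D : ℝ≥0∞} {C : ℝ} (hC : 0 < C) (hN : N ≠ ⊤)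
    (hA : N ≤ A * ENNReal.ofReal C)
    (hS : A ^ (1 / 2 : ℝ) ≤ B ^ (1 / 2 : ℝ) + N ^ (1 / 2 : ℝ) * D ^ (1 / 2 : ℝ))
    (hD : D ≤ ENNReal.ofReal (1 / (4 * C))) :
    ENNReal.ofReal (1 / (4 * C)) * N ≤ B := by
  set K := ENNReal.ofReal C with hK
  have hK0 : K ≠ 0 := by
    rw [hK, ne_eq, ENNReal.ofReal_eq_zero, not_le]; exact hC
  have h4 : (4 : ℝ≥0∞) ≠ 0 := by norm_num
  have h4top : (4 : ℝ≥0∞) ≠ ⊤ := ENNReal.ofNat_ne_top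
  -- `1/(4C)` as an `ℝ≥0∞` inverse
  have h4C : ENNReal.ofReal (1 / (4 * C)) = 4⁻¹ * K⁻¹ := by
    rw [one_div, ENNReal.ofReal_inv_of_pos (by positivity), ENNReal.ofReal_mul (by norm_num),
      ENNReal.ofReal_ofNat, ENNReal.mul_inv (Or.inl h4) (Or.inl h4top)]
  set Y := N / K with hY
  have hYtop : Y ≠ ⊤ := ENNReal.div_ne_top hN hK0
  have hYA : Y ≤ A := ENNReal.div_le_of_le_mul hA
  have hNY : ENNReal.ofReal (1 / (4 * C)) * N = Y / 4 := by
    rw [h4C, hY, div_eq_mul_inv, div_eq_mul_inv]; ring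
  set s := Y ^ (1 / 2 : ℝ) with hs
  have hstop : s ≠ ⊤ := ENNReal.rpow_ne_top_of_nonneg (by norm_num) hYtop
  have h1 : s ≤ A ^ (1 / 2 : ℝ) := ENNReal.rpow_le_rpow hYA (by norm_num)
  have h2 : N ^ (1 / 2 : ℝ) * D ^ (1 / 2 : ℝ) ≤ s / 2 := by
    calc N ^ (1 / 2 : ℝ) * D ^ (1 / 2 : ℝ)
        ≤ N ^ (1 / 2 : ℝ) * (ENNReal.ofReal (1 / (4 * C))) ^ (1 / 2 : ℝ) :=
          mul_le_mul_right (ENNReal.rpow_le_rpow hD (by norm_num)) _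
      _ = (ENNReal.ofReal (1 / (4 * C)) * N) ^ (1 / 2 : ℝ) := by
          rw [ENNReal.mul_rpow_of_nonneg _ _ (by norm_num), mul_comm]
      _ = s / 2 := by
          rw [hNY, ENNReal.div_rpow_of_nonneg _ _ (by norm_num), ennreal_four_rpow_half]
  have h3 : s ≤ B ^ (1 / 2 : ℝ) + s / 2 := h1.trans (hS.trans (add_le_add le_rfl h2))
  have h4' : s / 2 ≤ B ^ (1 / 2 : ℝ) := by
    rw [← ENNReal.sub_half hstop]
    exact tsub_le_iff_right.mpr h3
  have h5 : (s / 2) ^ (2 : ℝ) ≤ B := by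
    rw [one_div] at h4'
    exact (ENNReal.le_rpow_inv_iff (by norm_num : (0 : ℝ) < 2)).mp h4'
  calc ENNReal.ofReal (1 / (4 * C)) * N = Y / 4 := hNY
    _ = (s / 2) ^ (2 : ℝ) := by
        rw [ENNReal.div_rpow_of_nonneg _ _ (by norm_num), hs, one_div,
          ENNReal.rpow_inv_rpow (by norm_num), ENNReal.rpow_two]
        norm_num
    _ ≤ B := h5

/-- **Item stmt-AtomisticToContinuum-8961** (`LandscapeToPeriodicBEC`, assembly glue of route
BECNewtonPolicyIteration): the periodic landscape bound, periodic rigidity, the flat-mode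
inequality and occupation stability together give constant-mode BEC (`n₀ ≥ N/(4C)`) of every
periodic `δ`-near-minimiser on the torus of side `(N/ρ)^{1/3}`, for all small `ρ`, eventually in
`N` — the hypothesis of the shared boundary transfer `BoundaryTransferWeak`. [folklore] -/
theorem landscapeToPeriodicBEC_proof :
    Summit.AtomisticToContinuum.BoseEinsteinCondensation.Theses.BECNewtonPolicyIteration.LandscapeToPeriodicBEC := by
  unfold Summit.AtomisticToContinuum.BoseEinsteinCondensation.Theses.BECNewtonPolicyIteration.LandscapeToPeriodicBEC
  intro h₁ h₂ h₃ h₄ v hv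
  obtain ⟨ρ₁, hρ₁, H₁⟩ := h₁ v hv
  obtain ⟨ρ₂, hρ₂, H₂⟩ := h₂ v hv
  refine ⟨min ρ₁ ρ₂, lt_min hρ₁ hρ₂, fun ρ hρ hρlt => ?_⟩
  obtain ⟨C, hC, HL⟩ := H₁ ρ hρ (hρlt.trans_le (min_le_left _ _))
  have HR := H₂ ρ hρ (hρlt.trans_le (min_le_right _ _))
  refine ⟨1 / (4 * C), by positivity, ?_⟩
  obtain ⟨a, ha⟩ := Filter.eventually_atTop.1 HL
  filter_upwards [HR, eventually_ge_atTop (a + 1)] with N hRN haN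
  obtain ⟨n, rfl⟩ : ∃ n, N = n + 1 := ⟨N - 1, by omega⟩
  have hLn := ha n (by omega)
  -- the box is non-degenerate
  have hL : 0 < sideLength ρ (n + 1) := by
    unfold sideLength
    exact Real.rpow_pos_of_pos (div_pos (by exact_mod_cast Nat.succ_pos n) hρ) _
  -- rigidity at tolerance η = 1/(4C)
  obtain ⟨δ, hδ, hrig⟩ := hRN (1 / (4 * C)) (by positivity)
  refine ⟨δ, hδ, fun Φ hΦ => ?_⟩
  -- the nonnegative near-minimiser of the landscape bound
  obtain ⟨Ψ, hΨ, hpos, hI⟩ := hLn δ hδ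
  -- flat-mode inequality: N ≤ n₀(Ψ) · landscape ratio ≤ n₀(Ψ) · C
  have hA : ((n + 1 : ℕ) : ℝ≥0∞) ≤
      condensateOccupation (n + 1) (sideLength ρ (n + 1)) Ψ.ψ * ENNReal.ofReal C :=
    (h₃ n (sideLength ρ (n + 1)) hL Ψ hpos).trans (mul_le_mul_right hI _)
  -- rigidity: Ψ and Φ are L²-close up to a phase
  obtain ⟨c₁, hc₁, hclose⟩ := hrig Ψ Φ hΨ hΦ
  -- occupation stability
  have hS := h₄ (n + 1) (sideLength ρ (n + 1)) Ψ Φ c₁ hc₁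
  rw [ENNReal.ofReal_mul (by positivity), ENNReal.ofReal_natCast]
  exact occupation_transfer_ennreal hC (ENNReal.natCast_ne_top _) hA hS hclose

end Summit.AtomisticToContinuum.BoseEinsteinCondensation.Theorems
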